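import Mathlib
import Summits.ResolutionOfSingularities.ResolutionOfSingularities.Theorems.SyzygyFlatteningDefs
import Summits.ResolutionOfSingularities.ResolutionOfSingularities.Theorems.SyzygyFlatteningHigherRankTerminationRankLeOneDimZero
import Summits.ResolutionOfSingularities.ResolutionOfSingularities.Theorems.SyzygyFlatteningHigherRankTerminationGenericRadius
import Summits.ResolutionOfSingularities.ResolutionOfSingularities.Theorems.SyzygyFlatteningHigherRankTerminationGaussExtension
import Summits.ResolutionOfSingularities.ResolutionOfSingularities.Theorems.SyzygyFlatteningHigherRankTerminationResidueTrdegDrop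
import Summits.ResolutionOfSingularities.ResolutionOfSingularities.Theorems.SyzygyFlatteningHigherRankTerminationTrdegRatFunc
import Summits.ResolutionOfSingularities.ResolutionOfSingularities.Theorems.SyzygyFlatteningHigherRankTerminationGroundFieldUnits
import Summits.ResolutionOfSingularities.ResolutionOfSingularities.Theorems.SyzygyFlatteningHigherRankTerminationRealValuedTwoOverrings
import Summits.ResolutionOfSingularities.ResolutionOfSingularities.Theorems.SyzygyFlatteningHigherRankTerminationRankOneRealValued
import Summits.ResolutionOfSingularities.ResolutionOfSingularities.Theorems.SyzygyFlatteningHigherRankTerminationResidueTrdegCases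
import Summits.ResolutionOfSingularities.ResolutionOfSingularities.Theorems.SyzygyFlatteningHigherRankTerminationBaseChangeModel
import Summits.ResolutionOfSingularities.ResolutionOfSingularities.Theorems.SyzygyFlatteningHigherRankTerminationTowerBaseChange
import Literature.AlgebraicGeometry.Resolution.TranscendenceDefect
import HarnessLib

/-!
# `RankOneInput p ⇒` termination along EVERY rank-one valuation (`stub_posDimRankOne`)

Crux `HigherRankTermination` (stmt-ResolutionOfSingularities-17045), line `birth`, lead c2: the
induction on the residual transcendence degree that answers route-review objection O1 INSIDE the
crux. `RankOneInput p` is the route's crux #2 at `p`: termination of the syzygy-flattening tower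
along every rank-one valuation ring `O ⊇ k` of `K = Frac A` whose residue field is ALGEBRAIC over
`k` (dimension zero), at the index `n = tr.deg_k K`. We prove that it implies termination along every
rank-one `O`, of any residual transcendence degree `s`, at the same index:

* `s = 0` is the hypothesis (`stub_residueTrdeg_cases`: `residueTrdeg = 0 ⇒ DimZero`).
* `s > 0`: make `O` real-valued (`stub_rankOne_realValued`), pick `ζ ∈ O` with transcendental
  residue (`stub_residueTrdeg_cases`), a generic radius `c` (`stub_genericRadius`) and the Gauss
  extension `w` of the valuation to `K(X)` with `w(X - ζ) = c < 1` (`stub_gaussExtension`); over the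
  new ground field `k' = k(X) ⊆ O_w` (`stub_groundField_units`) the residual transcendence degree
  has dropped (`stub_residueTrdeg_drop`), the index has not (`stub_trdeg_ratFunc`), `O_w` is again
  rank one (`stub_realValued_twoOverrings`), the base-changed model `k'·A` is again a finitely
  generated model of `K(X)` (`stub_baseChange_model`); by induction the tower along `O_w` from
  `k'·A` terminates, and `towerTerminates_of_baseChange` (the tower commutes with the base change;
  regularity descends along the flat local maps of stages) brings termination back to `O`.

Main results: `allRankOne_of_rankOneInput` (with `O ≠ ⊤ ∧ TwoOverrings O`),
`allRankOne_of_rankOneInput'` (with `ringKrullDim O = 1`, the form of crux #2 without its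
dimension-zero binder), `stub_posDimRankOne` (the registered stub of the line `birth`), and
`rankOneInput_iff_allRankOne`.

References: Kuhlmann 2010, Lemma 2.5 (value-transcendental extensions keep the residue field);
Zariski–Samuel II, VI §10; Novacoski–Spivakovsky 2014, Thm. 1.1 (shape of the reduction);
Matsumura 23.7 (i).
-/

noncomputable section

-- single-problem summit: the doubled namespace component `ResolutionOfSingularities` is forced
set_option linter.dupNamespace false

namespace Summit.ResolutionOfSingularities.ResolutionOfSingularities.Theorems.SyzygyFlattening

open scoped NNReal
open Literature.AlgebraicGeometry.Resolution

/-! ## Finiteness of the transcendence degree of a finitely generated model -/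

/-- `tr.deg_k K < ℵ₀` when `K = Frac A` for a finitely generated `k`-subalgebra `A ⊆ K`. [folklore] -/
theorem trdeg_lt_aleph0_of_fg_model {k K : Type} [Field k] [Field K] [Algebra k K]
    (A : Subalgebra k K) (hFG : A.FG) (hFrac : IsFractionRing ↥A K) :
    Algebra.trdeg k K < Cardinal.aleph0 := by
  obtain ⟨s, hs⟩ := hFG
  subst hs
  haveI : IsFractionRing ↥(Algebra.adjoin k (s : Set K)) K := hFrac
  haveI : Algebra.IsAlgebraic ↥(Algebra.adjoin k (s : Set K)) K :=
    IsLocalization.isAlgebraic K (nonZeroDivisors ↥(Algebra.adjoin k (s : Set K)))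
  exact (Algebra.IsAlgebraic.trdeg_le_cardinalMk k (s : Set K)).trans_lt
    (Cardinal.lt_aleph0_of_finite _)

/-! ## The induction on the residual transcendence degree -/

/-- **The inductive statement**: `RankOneInput p` gives termination along every rank-one valuation
ring whose residual transcendence degree over the ground field is at most `n`. [cite: Kuhlmann2010, Lemma 2.5] -/
theorem towerTerminates_rankOne_of_residueTrdeg_le (p : ℕ) (hR1 : RankOneInput p) (n : ℕ) :
    ∀ (k K : Type) [Field k] [CharP k p] [Field K] [Algebra k K] (O : ValuationSubring K)
      (A : Subalgebra k K) (hk : ∀ c : k, algebraMap k K c ∈ O), A.FG → IsFractionRing ↥A K →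
      A.toSubring ≤ O.toSubring → O ≠ ⊤ → TwoOverrings O →
      Cardinal.toNat (residueTrdeg k O hk) ≤ n → TowerTerminates O A := by
  induction n with
  | zero =>
    intro k K _ _ _ _ O A hk hFG hFrac hAO hOtop h2 hle
    have htr := trdeg_lt_aleph0_of_fg_model A hFG hFrac
    have hfin := residueTrdeg_lt_aleph0 O hk htr
    obtain ⟨v, hvO, -⟩ := stub_rankOne_realValued K O hOtop h2
    have hdim : DimZero k O :=
      (stub_residueTrdeg_cases k K O hk hfin v hvO).1 (Nat.le_zero.mp hle)
    exact hR1 k K O A hk hFG hFrac hAO hdim (rankLeOne_ringKrullDim_eq_one O hOtop h2)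
  | succ n ih =>
    intro k K _ _ _ _ O A hk hFG hFrac hAO hOtop h2 hle
    by_cases hle' : Cardinal.toNat (residueTrdeg k O hk) ≤ n
    · exact ih k K O A hk hFG hFrac hAO hOtop h2 hle'
    have hpos : 0 < Cardinal.toNat (residueTrdeg k O hk) := by omega
    have htr := trdeg_lt_aleph0_of_fg_model A hFG hFrac
    have hfin := residueTrdeg_lt_aleph0 O hk htr
    -- real-valued form of `O`, a residue-transcendental `ζ`, a generic radius, the Gauss extension
    obtain ⟨v, hvO, x₀, hx₀⟩ := stub_rankOne_realValued K O hOtop h2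
    obtain ⟨ζ, hζO, hζ⟩ := (stub_residueTrdeg_cases k K O hk hfin v hvO).2 hpos
    obtain ⟨c, hc0, hc1, hgen⟩ := stub_genericRadius k K O hk htr v hvO
    obtain ⟨w, hwK, hwX, hwdom, hwnf⟩ := stub_gaussExtension K v c hc0 hc1 hgen ζ
    have hwXlt : w (RatFunc.X - algebraMap K (RatFunc K) ζ) < 1 := by rw [hwX]; exact hc1
    -- the new valuation ring `O'` and ground field `k' = k(X)`
    set O' : ValuationSubring (RatFunc K) := w.valuationSubring with hO'def
    have hwO' : ∀ y : RatFunc K, w y ≤ 1 ↔ y ∈ O' := fun y =>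
      (Valuation.mem_valuationSubring_iff w y).symm
    have hcomap : ∀ x : K, x ∈ O ↔ algebraMap K (RatFunc K) x ∈ O' := fun x => by
      rw [← hwO', hwK, hvO]
    have hOO' : ∀ x : K, x ∈ O → algebraMap K (RatFunc K) x ∈ O' := fun x hx => (hcomap x).mp hx
    let F : IntermediateField k (RatFunc K) := IntermediateField.adjoin k {(RatFunc.X : RatFunc K)}
    have hrange : Set.range (algebraMap ↥F (RatFunc K)) =
        ((IntermediateField.adjoin k {(RatFunc.X : RatFunc K)} : IntermediateField k (RatFunc K)) :
          Set (RatFunc K)) := by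
      ext y
      constructor
      · rintro ⟨g, rfl⟩
        exact g.2
      · intro hy
        exact ⟨⟨y, hy⟩, rfl⟩
    haveI : CharP ↥F p := charP_of_injective_algebraMap (algebraMap k ↥F).injective p
    have hk'O' : ∀ g : ↥F, algebraMap ↥F (RatFunc K) g ∈ O' := fun g => by
      rw [← hwO']
      by_cases hg : g = 0
      · rw [hg, map_zero, map_zero]
        exact zero_le_one
      · exact (stub_groundField_units k K O hk v hvO ζ hζO hζ w hwK hwXlt hwdom ↥F hrange g hg).le
    -- rank one again, same index, smaller residual transcendence degree
    obtain ⟨hO'top, h2'⟩ := stub_realValued_twoOverrings (RatFunc K) w O' hwO'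
      ⟨algebraMap K (RatFunc K) x₀, by rw [hwK]; exact hx₀⟩
    have htr' : Algebra.trdeg ↥F (RatFunc K) = Algebra.trdeg k K :=
      stub_trdeg_ratFunc k K htr ↥F hrange
    have hidx : syzygyIndex ↥F (RatFunc K) = syzygyIndex k K := by
      unfold syzygyIndex
      rw [htr']
    have hdrop := stub_residueTrdeg_drop k K O hk v hvO ζ hζO hζ w hwK hwXlt hwnf O' hwO' ↥F hrange
      hk'O' hfin hpos
    -- the base-changed model
    set A' : Subalgebra ↥F (RatFunc K) :=
      Algebra.adjoin ↥F ((algebraMap K (RatFunc K)) '' (A : Set K)) with hA'def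
    obtain ⟨hFG', hFrac', -⟩ := stub_baseChange_model k K ↥F hrange A A' rfl
    have hA'O' : A'.toSubring ≤ O'.toSubring := bc_toSubring_le O O' hOO' hk'O' A hAO
    -- induction, then transfer back along the base change
    have hterm' : TowerTerminates O' A' :=
      ih ↥F (RatFunc K) O' A' hk'O' (hFG' hFG) (hFrac' hFrac) hA'O' hO'top h2' (by omega)
    exact towerTerminates_of_baseChange hrange O O' hcomap hk hk'O' hidx A hFG hFrac hAO hterm'

/-- **`RankOneInput p` implies termination along EVERY rank-one valuation ring** (any residual
transcendence degree — route-review objection O1 answered inside the crux), in the overring form of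
"rank one". [cite: Kuhlmann2010, Lemma 2.5] -/
theorem allRankOne_of_rankOneInput (p : ℕ) (hR1 : RankOneInput p) :
    ∀ (k K : Type) [Field k] [CharP k p] [Field K] [Algebra k K] (O : ValuationSubring K)
      (A : Subalgebra k K), (∀ c : k, algebraMap k K c ∈ O) → A.FG → IsFractionRing ↥A K →
      A.toSubring ≤ O.toSubring → O ≠ ⊤ → TwoOverrings O → TowerTerminates O A :=
  fun k K _ _ _ _ O A hk hFG hFrac hAO hOtop h2 =>
    towerTerminates_rankOne_of_residueTrdeg_le p hR1 _ k K O A hk hFG hFrac hAO hOtop h2 le_rfl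

/-! ## Krull dimension one: the two-overring form -/

/-- A valuation subring of Krull dimension `1` is not the whole field. [cite: ZariskiSamuel1960, VI §10] -/
theorem ne_top_of_ringKrullDim_eq_one {K : Type} [Field K] (O : ValuationSubring K)
    (h : ringKrullDim ↥O = 1) : O ≠ ⊤ := by
  intro hO
  subst hO
  have hF : IsField ↥(⊤ : ValuationSubring K) :=
    { exists_pair_ne := ⟨0, 1, zero_ne_one⟩
      mul_comm := mul_comm
      mul_inv_cancel := fun {a} ha =>
        ⟨⟨(a : K)⁻¹, trivial⟩, Subtype.ext (mul_inv_cancel₀ fun h0 => ha (Subtype.ext h0))⟩ }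
  rw [ringKrullDim_eq_zero_of_isField hF] at h
  exact zero_ne_one h

/-- A valuation subring of Krull dimension `1` has exactly the two overrings itself and the field
(its primes are `⊥` and the maximal ideal; overrings correspond to primes). [cite: ZariskiSamuel1960, VI §10] -/
theorem twoOverrings_of_ringKrullDim_eq_one {K : Type} [Field K] (O : ValuationSubring K)
    (h : ringKrullDim ↥O = 1) : TwoOverrings O := by
  haveI : Ring.KrullDimLE 1 ↥O := by
    rw [Ring.krullDimLE_iff, h]
    exact le_rfl
  intro S hS
  -- `S = O.ofPrime P` for the prime `P = idealOfLE O S hS`; `P = ⊥` or `P` is maximal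
  by_cases hP : O.idealOfLE S hS = ⊥
  · right
    refine top_le_iff.mp ?_
    rw [← ValuationSubring.ofPrime_bot O, ← ValuationSubring.ofPrime_idealOfLE O S hS]
    exact ValuationSubring.ofPrime_le_of_le O _ _ hP.le
  · left
    have hmax : (O.idealOfLE S hS).IsMaximal := Ideal.IsPrime.isMaximal_of_ne_bot inferInstance hP
    have heq : O.idealOfLE S hS = IsLocalRing.maximalIdeal ↥O := IsLocalRing.eq_maximalIdeal hmax
    refine le_antisymm ?_ hS
    rw [← ValuationSubring.ofPrime_idealOfLE O S hS]
    calc O.ofPrime (O.idealOfLE S hS) ≤ O.ofPrime (IsLocalRing.maximalIdeal ↥O) :=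
          ValuationSubring.ofPrime_le_of_le O _ _ heq.ge
      _ = O := ValuationSubring.ofPrime_top O

/-- **`RankOneInput p` implies crux #2 WITHOUT its dimension-zero binder** (`ringKrullDim O = 1`
form): the filed hypothesis of `HigherRankTermination` already yields termination along every
rank-one valuation at the ambient index. [cite: Kuhlmann2010, Lemma 2.5] -/
theorem allRankOne_of_rankOneInput' (p : ℕ) (hR1 : RankOneInput p) :
    ∀ (k K : Type) [Field k] [CharP k p] [Field K] [Algebra k K] (O : ValuationSubring K)
      (A : Subalgebra k K), (∀ c : k, algebraMap k K c ∈ O) → A.FG → IsFractionRing ↥A K →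
      A.toSubring ≤ O.toSubring → ringKrullDim ↥O = 1 → TowerTerminates O A :=
  fun k K _ _ _ _ O A hk hFG hFrac hAO hdim =>
    allRankOne_of_rankOneInput p hR1 k K O A hk hFG hFrac hAO (ne_top_of_ringKrullDim_eq_one O hdim)
      (twoOverrings_of_ringKrullDim_eq_one O hdim)

/-- **`RankOneInput p` (rank one AND dimension zero) is EQUIVALENT to rank-one termination in every
dimension** at the prime `p`. [folklore] -/
theorem rankOneInput_iff_allRankOne (p : ℕ) :
    RankOneInput p ↔
      ∀ (k K : Type) [Field k] [CharP k p] [Field K] [Algebra k K] (O : ValuationSubring K)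
        (A : Subalgebra k K), (∀ c : k, algebraMap k K c ∈ O) → A.FG → IsFractionRing ↥A K →
        A.toSubring ≤ O.toSubring → ringKrullDim ↥O = 1 → TowerTerminates O A :=
  ⟨allRankOne_of_rankOneInput' p, fun h k K _ _ _ _ O A hk hFG hFrac hAO _ hdim =>
    h k K O A hk hFG hFrac hAO hdim⟩

/-! ## The registered stub of the line `birth` -/

/-- **STUB `stub_posDimRankOne` (crux stmt-ResolutionOfSingularities-17045, line `birth`) — PROVED.**
From `RankOneTermination` at `p` (`RankOneInput p`): the tower terminates along the rank-one
coarsening `O₁` (`O < O₁ < K`, two overrings) of a dimension-zero valuation ring `O` of rank ≥ 2 —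
a rank-one valuation of POSITIVE dimension. The base change `k ↦ k(t) ⊂ O₁` of the route text
changes the index; the base change `(k, K) ↦ (k(X), K(X))` along a value-transcendental extension
does not, and reduces the residual transcendence degree one step at a time
(`allRankOne_of_rankOneInput`). [cite: Kuhlmann2010, Lemma 2.5] -/
theorem stub_posDimRankOne : ∀ (p : ℕ), p.Prime → RankOneInput p →
    ∀ (k K : Type) [Field k] [CharP k p] [Field K] [Algebra k K] (O : ValuationSubring K)
      (A : Subalgebra k K), (∀ c : k, algebraMap k K c ∈ O) → A.FG → IsFractionRing ↥A K →
      A.toSubring ≤ O.toSubring → DimZero k O →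
      ∀ O₁ : ValuationSubring K, O < O₁ → O₁ ≠ ⊤ → TwoOverrings O₁ → TowerTerminates O₁ A := by
  intro p _ hR1 k K _ _ _ _ O A hk hFG hFrac hAO _ O₁ hlt hO₁top h2
  exact allRankOne_of_rankOneInput p hR1 k K O₁ A (fun c => hlt.le (hk c)) hFG hFrac
    (fun x hx => hlt.le (hAO hx)) hO₁top h2

end Summit.ResolutionOfSingularities.ResolutionOfSingularities.Theorems.SyzygyFlattening

end
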